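import Literature.Analysis.FluidPDE.OseenHeatSemigroup
import Literature.Analysis.FluidPDE.OseenHeatLinear
import Literature.Analysis.FluidPDE.OseenHeatDuhamel
import Literature.Analysis.FluidPDE.LerayHopf
import Mathlib.Analysis.SpecialFunctions.Integrals.Basic
import HarnessLib

/-!
# The Oseen–Duhamel integral `∫₀ᵗ e^{ν(t-s)Δ} P∇·F(s) ds` of a bounded, sup-norm continuous forcing

Analysis/FluidPDE support file, second layer of the physical-space (`L^∞`) theory of mild solutions
of the Navier–Stokes equations with bounded data (Leray 1934, Ch. III; Ożański–Pooley 2018, §6.3),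
towards the discharge of the named fact `Literature.Analysis.FluidPDE.leray_strong_local_existence`
(`NSLerayBlowupRate.lean`). The mild (integral) form of the equations is
`u(t) = e^{νtΔ} u₀ - ∫₀ᵗ 𝒩_{ν(t-s)} [u(s) ⊗ u(s)] ds`, `𝒩_τ = e^{τΔ} P∇·` (Leray 1934, (3.2);
Ożański–Pooley 2018, (6.47), (6.55); Kato 1984, (1.7)), with `𝒩_τ` the tree's heat-flow realisation
`oseenHeat` (`OseenHeat.lean`, `OseenHeatSemigroup.lean`). This file sets up the nonlinear term as an
honest pointwise object and proves its **`L^∞` ("sup-norm") calculus**, in dimension three: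

* `frameTensor v w` — the matrix field `(v ⊗ w)ⱼₖ = vⱼ wₖ` in the standard frame; `oseenVec τ F` — the
  vector `∑ᵢ (𝒩_τ F)ᵢ bᵢ`; `mildDuhamel ν F t x = ∫_{s ∈ (0,t)} 𝒩_{ν(t-s)} F(s) (x) ds` (Bochner
  integral in `s`, pointwise in `x`; `0` for `t ≤ 0`);
* `IsBddCtsForcing T B F` — forcings on `(0, T]` with `L^∞` slice components, a uniform componentwise
  bound `B` and **continuity of `s ↦ F(s)` in `L^∞`** within `(0, T]`; `IsBddCtsVelocity T M v` — the
  corresponding velocity class (`C((0,T]; L^∞)`, the class of Leray's regular / Ożański–Pooley's strong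
  solutions, Def. 6.14), whose tensor products are such forcings
  (`IsBddCtsVelocity.isBddCtsForcing_frameTensor`, bound `Mv Mw`);
* linearity of the vector operator and of `𝒟 = mildDuhamel` on bounded data (`oseenVec_sub_of_top`,
  from the tree's `oseenHeat_sub_of_memLp` of `OseenHeatLinear.lean`; `mildDuhamel_sub`), the pointwise bound `‖𝒩_τ F‖ ≤ 8829 τ^{-1/2} B` and
  the vector modulus `‖𝒩_{τ'} F - 𝒩_τ F‖ ≤ 2862000 B (τ^{-1/2} - τ'^{-1/2})`;
* **the Duhamel integrand `s ↦ 𝒩_{ν(t-s)} F(s) (x)` is continuous on `(0, t)`**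
  (`continuousOn_mildDuhamelIntegrand`: linearity plus the `L^∞` operator bound absorb the variation of
  the data, the modulus in `τ` absorbs the variation of the clock — no dominated convergence), hence
  integrable with the majorant `8829 B (ν(t-s))^{-1/2}`;
* the **bounds and continuity of `𝒟_ν[F]`**: `‖𝒟_ν[F](t)(x)‖ ≤ 17658 ν^{-1/2} B t^{1/2}`
  (`norm_mildDuhamel_le`; Leray 1934, (2.13); Ożański–Pooley 2018, Lemma 6.9 (i)), continuity in `x`
  (`continuous_mildDuhamel_space`), the **Hölder-`½` modulus in time, uniformly in `x`**,
  `‖𝒟(t') - 𝒟(t)‖_∞ ≤ 5742000 B ν^{-1/2} (t' - t)^{1/2}` (`norm_mildDuhamel_sub_le'`), joint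
  continuity on `[0, T] × E` (`continuousOn_mildDuhamel`) and sup-norm continuity in `t`
  (`tendsto_eLpNorm_mildDuhamel_sub`).

All of this is the content of Leray 1934, §§11–12 (the integrals of Ch. II are bounded and
"uniformément continues en `t`") and Ożański–Pooley 2018, Lemma 6.9 (i), (iii), in the form needed
for the Picard iteration of §19 / Thm. 6.22 in the space of bounded, sup-norm continuous fields
(next layer). Numerical constants are explicit but not optimised. Everything is proved.

## Mathlib / tree search

Tree: `OseenHeat`, `OseenHeatSemigroup` (all of it), `OseenHeatLinear` (linearity of `𝒩_τ` on `Lᵖ`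
data, used at `p = ∞`: `oseenHeat_sub_of_memLp`), `HeatKernel*` (`heatExtension`,
`contDiff_heatExtension_holds`). `OseenDuhamelMeasurable.lean` (landed 2026-08-15) develops the same
heat-flow vector Duhamel integral `∫ₛᵗ Σᵢ (𝒩_{t-σ}F(σ))ᵢ eᵢ dσ` (our `oseenVec` inlined, `ν = 1`, start time
`s`) with the same constant chain (size bound, continuity in `x`, Hölder-½ in `t`, joint continuity,
restart) under **bounded + jointly measurable** forcing and no time continuity (the KNSS drift `b(t)` is
only measurable); the present file assumes **`L^∞` continuity in time** and no joint measurability — the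
class of the Picard iterates of Leray's `L^∞` theory (`NSPicardLinfty`), whose forcings `u ⊗ u` are not
known to be jointly measurable before they are known to be continuous; the hypotheses are incomparable and
both files are needed. The `cont` fields of `IsBddCtsForcing`/`IsBddCtsVelocity` are (componentwise) the
second conjunct of the tree's `ContinuousInLpOn (Ioc 0 T) ∞` (`LerayHopf.lean`), see
`IsBddCtsVelocity.continuousInLpOn`. `OseenHeatDuhamel.lean` (landed 2026-08-15, imported here for
`frameTensor`) defines the bilinear component form `oseenHeatDuhamel ν s u v t i x = ∫ (𝒩_{ν(t-τ)}(u ⊗ v))ᵢ`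
and `oseenHeatDuhamelVec` for bounded jointly measurable `u, v`, with the pairing identity against
divergence-free tests and weak divergence-freeness; on rank-one forcings of bounded sup-norm continuous
velocities our general-forcing integral coincides with it (`mildDuhamel_frameTensor_eq_oseenHeatDuhamelVec`,
`inner_mildDuhamel_frame`), so those facts transfer; the general matrix forcing is kept because the Picard
contraction uses differences `u ⊗ u - v ⊗ v` (`mildDuhamel_sub`), which are not rank one. `lean search 'Duhamel'` in the topic: `NSBoundedMildOseen.oseenDuhamel ν s u v`
(landed 2026-08-15) is the *kernel* realisation `∫ₛᵗ ∫ K(ν(t-τ), x-y)[u(τ,y), v(τ,y)] dy dτ` of the same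
bilinear operator on rank-one tensors `u ⊗ v` (Koch–Tataru kernel `oseenKernel`, KNSS 2009 architecture);
the present `mildDuhamel ν F` is the *heat-flow* realisation `∫₀ᵗ 𝒩_{ν(t-s)} F(s) ds` on general matrix
forcings `F` built from `oseenHeat` — a different definition (hence the distinct name), expected to agree
with `NSBoundedMildOseen.oseenDuhamel ν 0 v w` on `F = frameTensor v w` for bounded sup-norm continuous
`v, w` (identification not proved here). `heatDivTensor` of `MildSolution.lean` is the unprojected
`e^{τΔ} div (v ⊗ w)`, `heatDuhamelBack` the backward Duhamel integral of test fields. Mathlib: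
`MeasureTheory.continuous_of_dominated` (continuity in `x` only), `integral_rpow`,
`intervalIntegral.intervalIntegrable_rpow'`, `IntervalIntegrable.comp_sub_left`,
`setIntegral_union`, `norm_integral_le_of_norm_le`, `squeeze_zero_norm'`.

## References

* J. Leray, *Sur le mouvement d'un liquide visqueux emplissant l'espace*, Acta Math. 63 (1934),
  §8, §§11–12 ((2.13)–(2.18)), §15 (3.2). [Leray1934]
* W. S. Ożański, B. C. Pooley, *Leray's fundamental work on the Navier–Stokes equations: a modern
  review*, LMS Lecture Note Ser. 452 (CUP 2018), Lemma 6.9, Def. 6.14, (6.47), (6.55).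
  [OzanskiPooley2018]
* T. Kato, *Strong `Lᵖ`-solutions of the Navier–Stokes equation in `ℝᵐ`*, Math. Z. 187 (1984),
  (1.7). [Kato1984]
-/

open MeasureTheory Filter Topology Set InnerProductSpace Metric
open scoped Real ENNReal NNReal Convolution Laplacian RealInnerProductSpace

noncomputable section

namespace Literature.Analysis.FluidPDE

section Vector

variable {E : Type*} [NormedAddCommGroup E] [InnerProductSpace ℝ E] [FiniteDimensional ℝ E]
  [MeasurableSpace E] [BorelSpace E]

/-- The **vector-valued Oseen–heat operator** `𝒩_τ F = ∑ᵢ (𝒩_τ F)ᵢ bᵢ`. [folklore] -/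
def oseenVec (τ : ℝ) (F : Fin (Module.finrank ℝ E) → Fin (Module.finrank ℝ E) → E → ℝ) (x : E) : E :=
  ∑ i, oseenHeat τ F i x • stdOrthonormalBasis ℝ E i

/-- **The tensor field of bounded fields is bounded**: if `‖v‖ ≤ Mv` and `‖w‖ ≤ Mw` a.e. then
`(v ⊗ w)ⱼₖ ∈ L^∞` with `‖(v ⊗ w)ⱼₖ‖_∞ ≤ Mv Mw`. [folklore] -/
theorem memLp_top_frameTensor_of_ae {v w : E → E} (hv : AEStronglyMeasurable v volume)
    (hw : AEStronglyMeasurable w volume) {Mv Mw : ℝ} (hMv : ∀ᵐ y ∂volume, ‖v y‖ ≤ Mv)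
    (hMw : ∀ᵐ y ∂volume, ‖w y‖ ≤ Mw) (hMv0 : 0 ≤ Mv) (j k : Fin (Module.finrank ℝ E)) :
    MemLp (frameTensor v w j k) ∞ volume ∧
      eLpNorm (frameTensor v w j k) ∞ volume ≤ ENNReal.ofReal (Mv * Mw) := by
  have hb : ∀ᵐ y ∂volume, ‖frameTensor v w j k y‖ ≤ Mv * Mw := by
    filter_upwards [hMv, hMw] with y hy1 hy2
    rw [Real.norm_eq_abs]
    exact (Real.norm_eq_abs _).symm.le.trans ((norm_frameTensor_le v w j k y).trans (mul_le_mul hy1 hy2 (norm_nonneg _) hMv0))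
  exact ⟨memLp_top_of_bound (aestronglyMeasurable_frameTensor hv hw j k) _ hb,
    by rw [eLpNorm_exponent_top]; exact eLpNormEssSup_le_of_ae_bound hb⟩

omit [MeasurableSpace E] [BorelSpace E] in
/-- Difference of tensor fields: `v ⊗ w - v' ⊗ w' = (v - v') ⊗ w + v' ⊗ (w - w')`. [folklore] -/
theorem frameTensor_sub_frameTensor (v w v' w' : E → E) (j k : Fin (Module.finrank ℝ E)) (y : E) :
    frameTensor v w j k y - frameTensor v' w' j k y =
      frameTensor (v - v') w j k y + frameTensor v' (w - w') j k y := by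
  simp only [frameTensor, Pi.sub_apply, inner_sub_left]
  ring

variable (hE : Module.finrank ℝ E = 3)
include hE

variable {F G : Fin (Module.finrank ℝ E) → Fin (Module.finrank ℝ E) → E → ℝ}

/-- **Pointwise bound of the vector Oseen–heat operator**: `‖𝒩_τ F (x)‖ ≤ 8829 τ^{-1/2} B` when
`‖Fⱼₖ‖_∞ ≤ B` (three components of size `2943 τ^{-1/2} B`). [folklore] -/
theorem norm_oseenVec_le (hF : ∀ j k, MemLp (F j k) ∞ volume) {B : ℝ} (hB0 : 0 ≤ B)
    (hB : ∀ j k, eLpNorm (F j k) ∞ volume ≤ ENNReal.ofReal B) {τ : ℝ} (hτ : 0 < τ) (x : E) :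
    ‖oseenVec τ F x‖ ≤ 8829 * τ ^ (-(1 / 2 : ℝ)) * B := by
  unfold oseenVec
  have hsum : ‖∑ i, oseenHeat τ F i x • stdOrthonormalBasis ℝ E i‖ ≤ ∑ i, |oseenHeat τ F i x| := by
    refine (norm_sum_le _ _).trans (Finset.sum_le_sum fun i _ => ?_)
    rw [norm_smul, (stdOrthonormalBasis ℝ E).orthonormal.1 i, mul_one, Real.norm_eq_abs]
  refine hsum.trans ?_
  calc ∑ i, |oseenHeat τ F i x| ≤ ∑ _i : Fin (Module.finrank ℝ E), 2943 * τ ^ (-(1 / 2 : ℝ)) * B :=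
        Finset.sum_le_sum fun i _ => (Real.norm_eq_abs _).symm.le.trans (norm_oseenHeat_le_of_top hE hF hB0 hB hτ i x)
    _ = 8829 * τ ^ (-(1 / 2 : ℝ)) * B := by
        rw [Finset.sum_const, Finset.card_univ, Fintype.card_fin, hE, nsmul_eq_mul]; push_cast; ring

/-- Linearity of the vector Oseen–heat operator on bounded data. [folklore] -/
theorem oseenVec_sub_of_top (hF : ∀ j k, MemLp (F j k) ∞ volume) (hG : ∀ j k, MemLp (G j k) ∞ volume)
    {τ : ℝ} (hτ : 0 < τ) (x : E) :
    oseenVec τ (fun j k => F j k - G j k) x = oseenVec τ F x - oseenVec τ G x := by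
  unfold oseenVec
  rw [← Finset.sum_sub_distrib]
  refine Finset.sum_congr rfl fun i _ => ?_
  rw [oseenHeat_sub_of_memLp hE le_top hF hG hτ i x, sub_smul]

/-- **Modulus of continuity of `𝒩` in the time parameter, vector form**:
`‖𝒩_{τ'} F (x) - 𝒩_τ F (x)‖ ≤ 2862000 B (τ^{-1/2} - τ'^{-1/2})` for `0 < τ ≤ τ'`. [folklore] -/
theorem norm_oseenVec_sub_le (hF : ∀ j k, MemLp (F j k) ∞ volume) {B : ℝ} (hB0 : 0 ≤ B)
    (hB : ∀ j k, eLpNorm (F j k) ∞ volume ≤ ENNReal.ofReal B) {τ τ' : ℝ} (hτ : 0 < τ)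
    (hττ' : τ ≤ τ') (x : E) :
    ‖oseenVec τ' F x - oseenVec τ F x‖ ≤ 2862000 * B * (τ ^ (-(1 / 2 : ℝ)) - τ' ^ (-(1 / 2 : ℝ))) := by
  unfold oseenVec
  rw [← Finset.sum_sub_distrib]
  simp_rw [← sub_smul]
  have hsum : ‖∑ i, (oseenHeat τ' F i x - oseenHeat τ F i x) • stdOrthonormalBasis ℝ E i‖ ≤
      ∑ i, |oseenHeat τ' F i x - oseenHeat τ F i x| := by
    refine (norm_sum_le _ _).trans (Finset.sum_le_sum fun i _ => ?_)
    rw [norm_smul, (stdOrthonormalBasis ℝ E).orthonormal.1 i, mul_one, Real.norm_eq_abs]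
  refine hsum.trans ?_
  calc ∑ i, |oseenHeat τ' F i x - oseenHeat τ F i x|
      ≤ ∑ _i : Fin (Module.finrank ℝ E), 954000 * B * (τ ^ (-(1 / 2 : ℝ)) - τ' ^ (-(1 / 2 : ℝ))) :=
        Finset.sum_le_sum fun i _ => (Real.norm_eq_abs _).symm.le.trans
          (norm_oseenHeat_sub_le hE hF hB0 hB hτ hττ' i x)
    _ = 2862000 * B * (τ ^ (-(1 / 2 : ℝ)) - τ' ^ (-(1 / 2 : ℝ))) := by
        rw [Finset.sum_const, Finset.card_univ, Fintype.card_fin, hE, nsmul_eq_mul]; push_cast; ring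

/-- The vector Oseen–heat operator of bounded data is smooth in `x`. [folklore] -/
theorem contDiff_oseenVec (hF : ∀ j k, MemLp (F j k) ∞ volume) {τ : ℝ} (hτ : 0 < τ) {n : ℕ∞} :
    ContDiff ℝ n (oseenVec τ F) := by
  unfold oseenVec
  exact ContDiff.sum fun i _ => (contDiff_oseenHeat hE hF hτ i).smul contDiff_const

end Vector

section Duhamel

variable {E : Type*} [NormedAddCommGroup E] [InnerProductSpace ℝ E] [FiniteDimensional ℝ E]
  [MeasurableSpace E] [BorelSpace E]

/-- **The Oseen–Duhamel integral** `𝒟_ν[F](t)(x) = ∫₀ᵗ 𝒩_{ν(t-s)} F(s) (x) ds` of a time-dependent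
matrix field `F` — for `F(s) = u(s) ⊗ u(s)` the nonlinear term of the mild (integral) form of the
Navier–Stokes equations `u(t) = e^{νtΔ}u₀ - 𝒟_ν[u ⊗ u](t)` (Leray 1934, (3.2); Ożański–Pooley 2018,
(6.47), (6.55); Kato 1984, (1.7)). A Bochner integral over `s ∈ (0, t)` with values in `E`,
pointwise in `x`; it is `0` for `t ≤ 0`. (Heat-flow realisation through `oseenHeat`/`oseenVec` for a general sup-norm continuous matrix
forcing `F`; compare the tree's bilinear component form `OseenHeatDuhamel.oseenHeatDuhamel ν s u v t i x`
(bounded jointly measurable `u, v`, landed 2026-08-15) and the kernel realisation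
`NSBoundedMildOseen.oseenDuhamel ν s u v` = `kochTataruBilinear` on `u ⊗ v`.)
[folklore] -/
def mildDuhamel (ν : ℝ) (F : ℝ → Fin (Module.finrank ℝ E) → Fin (Module.finrank ℝ E) → E → ℝ)
    (t : ℝ) (x : E) : E :=
  ∫ s in Ioo 0 t, oseenVec (ν * (t - s)) (F s) x

/-- **Bounded, sup-norm continuous forcings** on `(0, T]`: every slice component is in `L^∞` with a
uniform bound `B`, and `s ↦ F(s)` is continuous in `L^∞` (componentwise) within `(0, T]`. This is the
class of `u ⊗ u` for `u` bounded and continuous into `L^∞` on `(0, T]` (Ożański–Pooley 2018,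
Def. 6.14: strong solutions are `C((0,T); L^∞)`). [folklore] -/
structure IsBddCtsForcing (T B : ℝ)
    (F : ℝ → Fin (Module.finrank ℝ E) → Fin (Module.finrank ℝ E) → E → ℝ) : Prop where
  memLp : ∀ s ∈ Ioc 0 T, ∀ j k, MemLp (F s j k) ∞ volume
  bound : ∀ s ∈ Ioc 0 T, ∀ j k, eLpNorm (F s j k) ∞ volume ≤ ENNReal.ofReal B
  nonneg : 0 ≤ B
  cont : ∀ s ∈ Ioc 0 T, ∀ j k, Tendsto (fun s' => eLpNorm (fun y => F s' j k y - F s j k y) ∞ volume)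
    (𝓝[Ioc 0 T] s) (𝓝 0)

variable (hE : Module.finrank ℝ E = 3)
include hE

variable {T B ν : ℝ} {F : ℝ → Fin (Module.finrank ℝ E) → Fin (Module.finrank ℝ E) → E → ℝ}

/-- **Pointwise bound of the Duhamel integrand**: `‖𝒩_{ν(t-s)} F(s) (x)‖ ≤ 8829 (ν(t-s))^{-1/2} B`
for `0 < s < t ≤ T`. [folklore] -/
theorem norm_mildDuhamelIntegrand_le (hF : IsBddCtsForcing T B F) (hν : 0 < ν) {t : ℝ} (ht : t ≤ T)
    {s : ℝ} (hs : s ∈ Ioo 0 t) (x : E) :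
    ‖oseenVec (ν * (t - s)) (F s) x‖ ≤ 8829 * (ν * (t - s)) ^ (-(1 / 2 : ℝ)) * B :=
  norm_oseenVec_le hE (hF.memLp s ⟨hs.1, hs.2.le.trans ht⟩) hF.nonneg
    (hF.bound s ⟨hs.1, hs.2.le.trans ht⟩) (mul_pos hν (sub_pos.2 hs.2)) x

/-- **Continuity of the Duhamel integrand in `s`** on `(0, t)` (linearity and the `L^∞` operator bound
for the variation of the data, the modulus of continuity in the time parameter for the variation of
the clock). [folklore] -/
theorem continuousOn_mildDuhamelIntegrand (hF : IsBddCtsForcing T B F) (hν : 0 < ν) {t : ℝ} (ht : t ≤ T)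
    (x : E) : ContinuousOn (fun s => oseenVec (ν * (t - s)) (F s) x) (Ioo 0 t) := by
  intro s hs
  have hsT : s ∈ Ioc 0 T := ⟨hs.1, hs.2.le.trans ht⟩
  rw [ContinuousWithinAt, tendsto_iff_norm_sub_tendsto_zero]
  -- notation
  set τ : ℝ → ℝ := fun s' => ν * (t - s') with hτ
  have hτs : 0 < τ s := mul_pos hν (sub_pos.2 hs.2)
  set δ : ℝ → ℝ := fun s' => ∑ j, ∑ k, (eLpNorm (fun y => F s' j k y - F s j k y) ∞ volume).toReal with hδ
  -- the majorant
  set bound : ℝ → ℝ := fun s' => 8829 * (τ s') ^ (-(1 / 2 : ℝ)) * δ s' +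
    2862000 * B * |(τ s) ^ (-(1 / 2 : ℝ)) - (τ s') ^ (-(1 / 2 : ℝ))| with hbound
  have hIoo : ∀ᶠ s' in 𝓝[Ioo 0 t] s, s' ∈ Ioo 0 t := eventually_mem_nhdsWithin
  -- (1) the majorant bounds the difference
  have hle : ∀ᶠ s' in 𝓝[Ioo 0 t] s, ‖oseenVec (τ s') (F s') x - oseenVec (τ s) (F s) x‖ ≤ bound s' := by
    filter_upwards [hIoo] with s' hs'
    have hs'T : s' ∈ Ioc 0 T := ⟨hs'.1, hs'.2.le.trans ht⟩
    have hτs' : 0 < τ s' := mul_pos hν (sub_pos.2 hs'.2)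
    have hmem' := hF.memLp s' hs'T
    have hmem := hF.memLp s hsT
    -- data variation
    have hD : ∀ j k, MemLp (fun y => F s' j k y - F s j k y) ∞ volume := fun j k => (hmem' j k).sub (hmem j k)
    have hδb : ∀ j k, eLpNorm (fun y => F s' j k y - F s j k y) ∞ volume ≤ ENNReal.ofReal (δ s') := by
      intro j k
      rw [← ENNReal.ofReal_toReal (hD j k).eLpNorm_ne_top]
      refine ENNReal.ofReal_le_ofReal ?_
      refine (Finset.single_le_sum (f := fun k => (eLpNorm (fun y => F s' j k y - F s j k y) ∞ volume).toReal)
        (fun _ _ => ENNReal.toReal_nonneg) (Finset.mem_univ k)).trans ?_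
      exact Finset.single_le_sum (f := fun j => ∑ k, (eLpNorm (fun y => F s' j k y - F s j k y) ∞ volume).toReal)
        (fun _ _ => Finset.sum_nonneg fun _ _ => ENNReal.toReal_nonneg) (Finset.mem_univ j)
    have hδ0 : 0 ≤ δ s' := Finset.sum_nonneg fun _ _ => Finset.sum_nonneg fun _ _ => ENNReal.toReal_nonneg
    have h1 : ‖oseenVec (τ s') (F s') x - oseenVec (τ s') (F s) x‖ ≤ 8829 * (τ s') ^ (-(1 / 2 : ℝ)) * δ s' := by
      rw [← oseenVec_sub_of_top hE hmem' hmem hτs' x]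
      exact norm_oseenVec_le hE hD hδ0 hδb hτs' x
    -- clock variation
    have h2 : ‖oseenVec (τ s') (F s) x - oseenVec (τ s) (F s) x‖ ≤
        2862000 * B * |(τ s) ^ (-(1 / 2 : ℝ)) - (τ s') ^ (-(1 / 2 : ℝ))| := by
      rcases le_total (τ s) (τ s') with h | h
      · refine (norm_oseenVec_sub_le hE hmem hF.nonneg (hF.bound s hsT) hτs h x).trans ?_
        exact mul_le_mul_of_nonneg_left (le_abs_self _) (mul_nonneg (by norm_num) hF.nonneg)
      · rw [norm_sub_rev]
        refine (norm_oseenVec_sub_le hE hmem hF.nonneg (hF.bound s hsT) hτs' h x).trans ?_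
        rw [abs_sub_comm]
        exact mul_le_mul_of_nonneg_left (le_abs_self _) (mul_nonneg (by norm_num) hF.nonneg)
    calc ‖oseenVec (τ s') (F s') x - oseenVec (τ s) (F s) x‖
        ≤ ‖oseenVec (τ s') (F s') x - oseenVec (τ s') (F s) x‖ +
            ‖oseenVec (τ s') (F s) x - oseenVec (τ s) (F s) x‖ := norm_sub_le_norm_sub_add_norm_sub _ _ _
      _ ≤ bound s' := add_le_add h1 h2
  -- (2) the majorant tends to zero
  have hτc : Tendsto τ (𝓝[Ioo 0 t] s) (𝓝 (τ s)) :=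
    ((continuous_const.mul (continuous_const.sub continuous_id)).tendsto s).mono_left nhdsWithin_le_nhds
  have hτr : Tendsto (fun s' => (τ s') ^ (-(1 / 2 : ℝ))) (𝓝[Ioo 0 t] s) (𝓝 ((τ s) ^ (-(1 / 2 : ℝ)))) :=
    hτc.rpow_const (Or.inl hτs.ne')
  have hδc : Tendsto δ (𝓝[Ioo 0 t] s) (𝓝 0) := by
    have h9 : Tendsto δ (𝓝[Ioc 0 T] s) (𝓝 (∑ _j : Fin (Module.finrank ℝ E), ∑ _k : Fin (Module.finrank ℝ E), (0:ℝ))) := by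
      refine tendsto_finsetSum _ fun j _ => tendsto_finsetSum _ fun k _ => ?_
      have := (ENNReal.tendsto_toReal ENNReal.zero_ne_top).comp (hF.cont s hsT j k)
      rwa [ENNReal.toReal_zero] at this
    simp only [Finset.sum_const_zero] at h9
    exact h9.mono_left (nhdsWithin_mono _ fun s' hs' => ⟨hs'.1, hs'.2.le.trans ht⟩)
  have hb0 : Tendsto bound (𝓝[Ioo 0 t] s) (𝓝 0) := by
    have h1 : Tendsto (fun s' => 8829 * (τ s') ^ (-(1 / 2 : ℝ)) * δ s') (𝓝[Ioo 0 t] s) (𝓝 0) := by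
      have := (hτr.const_mul 8829).mul hδc
      rwa [mul_zero] at this
    have h2 : Tendsto (fun s' => 2862000 * B * |(τ s) ^ (-(1 / 2 : ℝ)) - (τ s') ^ (-(1 / 2 : ℝ))|)
        (𝓝[Ioo 0 t] s) (𝓝 0) := by
      have := ((tendsto_const_nhds (x := (τ s) ^ (-(1 / 2 : ℝ)))).sub hτr).abs.const_mul (2862000 * B)
      rwa [sub_self, abs_zero, mul_zero] at this
    have := h1.add h2
    rwa [add_zero] at this
  exact squeeze_zero_norm' (hle.mono fun s' hs' => by rwa [norm_norm]) hb0

/-- The Duhamel integrand is a.e. strongly measurable on `(0, t)`. [folklore] -/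
theorem aestronglyMeasurable_mildDuhamelIntegrand (hF : IsBddCtsForcing T B F) (hν : 0 < ν) {t : ℝ}
    (ht : t ≤ T) (x : E) :
    AEStronglyMeasurable (fun s => oseenVec (ν * (t - s)) (F s) x) (volume.restrict (Ioo 0 t)) :=
  (continuousOn_mildDuhamelIntegrand hE hF hν ht x).aestronglyMeasurable measurableSet_Ioo

omit hE in
/-- The singular weight `s ↦ (t - s)^{-1/2}` is integrable on `(0, t)`, with
`∫₀ᵗ (t - s)^{-1/2} ds = 2 t^{1/2}`. [folklore] -/
theorem integral_rpow_neg_half_sub {t : ℝ} (ht : 0 ≤ t) :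
    IntegrableOn (fun s : ℝ => (t - s) ^ (-(1 / 2 : ℝ))) (Ioo 0 t) ∧
      ∫ s in Ioo 0 t, (t - s) ^ (-(1 / 2 : ℝ)) = 2 * t ^ (1 / 2 : ℝ) := by
  have hr : (-1 : ℝ) < -(1 / 2) := by norm_num
  have hii : IntervalIntegrable (fun u : ℝ => u ^ (-(1 / 2 : ℝ))) volume 0 t :=
    intervalIntegral.intervalIntegrable_rpow' hr
  have hii' : IntervalIntegrable (fun s : ℝ => (t - s) ^ (-(1 / 2 : ℝ))) volume 0 t := by
    have := (hii.comp_sub_left t).symm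
    simpa using this
  refine ⟨?_, ?_⟩
  · have := (intervalIntegrable_iff_integrableOn_Ioc_of_le ht).1 hii'
    exact (integrableOn_Ioc_iff_integrableOn_Ioo).1 this
  · rw [← integral_Ioc_eq_integral_Ioo, ← intervalIntegral.integral_of_le ht,
      intervalIntegral.integral_comp_sub_left (fun u : ℝ => u ^ (-(1 / 2 : ℝ))) t, sub_self, sub_zero,
      integral_rpow (Or.inl hr)]
    rw [show (-(1 / 2 : ℝ) + 1) = 1 / 2 by norm_num, Real.zero_rpow (by norm_num)]
    ring

/-- **The Duhamel integrand is integrable on `(0, t)`** (continuous with the integrable majorant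
`8829 B (ν(t-s))^{-1/2}`). [folklore] -/
theorem integrableOn_mildDuhamelIntegrand (hF : IsBddCtsForcing T B F) (hν : 0 < ν) {t : ℝ}
    (ht : t ∈ Ioc 0 T) (x : E) :
    IntegrableOn (fun s => oseenVec (ν * (t - s)) (F s) x) (Ioo 0 t) := by
  have hmaj : IntegrableOn (fun s : ℝ => 8829 * ν ^ (-(1 / 2 : ℝ)) * B * (t - s) ^ (-(1 / 2 : ℝ))) (Ioo 0 t) :=
    ((integral_rpow_neg_half_sub ht.1.le).1.const_mul _)
  refine hmaj.mono' (aestronglyMeasurable_mildDuhamelIntegrand hE hF hν ht.2 x) ?_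
  refine (ae_restrict_iff' measurableSet_Ioo).2 (Eventually.of_forall fun s hs => ?_)
  refine (norm_mildDuhamelIntegrand_le hE hF hν ht.2 hs x).trans (le_of_eq ?_)
  rw [Real.mul_rpow hν.le (sub_pos.2 hs.2).le]
  ring

/-- **`L^∞` bound of the Oseen–Duhamel integral**: `‖𝒟_ν[F](t)(x)‖ ≤ 17658 ν^{-1/2} B t^{1/2}` for
`0 < t ≤ T` (Leray 1934, (2.13); Ożański–Pooley 2018, Lemma 6.9 (i)). [folklore] -/
theorem norm_mildDuhamel_le (hF : IsBddCtsForcing T B F) (hν : 0 < ν) {t : ℝ} (ht : t ∈ Ioc 0 T)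
    (x : E) : ‖mildDuhamel ν F t x‖ ≤ 17658 * ν ^ (-(1 / 2 : ℝ)) * B * t ^ (1 / 2 : ℝ) := by
  unfold mildDuhamel
  have hmaj : IntegrableOn (fun s : ℝ => 8829 * ν ^ (-(1 / 2 : ℝ)) * B * (t - s) ^ (-(1 / 2 : ℝ))) (Ioo 0 t) :=
    ((integral_rpow_neg_half_sub ht.1.le).1.const_mul _)
  refine (norm_integral_le_of_norm_le hmaj ((ae_restrict_iff' measurableSet_Ioo).2
    (Eventually.of_forall fun s hs => ?_))).trans (le_of_eq ?_)
  · refine (norm_mildDuhamelIntegrand_le hE hF hν ht.2 hs x).trans (le_of_eq ?_)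
    rw [Real.mul_rpow hν.le (sub_pos.2 hs.2).le]
    ring
  · rw [integral_const_mul, (integral_rpow_neg_half_sub ht.1.le).2]
    ring

omit hE in
/-- For `t ≤ 0` the Oseen–Duhamel integral vanishes (empty time interval). [folklore] -/
theorem mildDuhamel_of_nonpos {t : ℝ} (ht : t ≤ 0) (x : E) : mildDuhamel ν F t x = 0 := by
  unfold mildDuhamel
  rw [Ioo_eq_empty (not_lt.2 ht), Measure.restrict_empty, integral_zero_measure]

end Duhamel

section DuhamelContinuity

variable {E : Type*} [NormedAddCommGroup E] [InnerProductSpace ℝ E] [FiniteDimensional ℝ E]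
  [MeasurableSpace E] [BorelSpace E]

variable (hE : Module.finrank ℝ E = 3)
include hE

variable {T B ν : ℝ} {F : ℝ → Fin (Module.finrank ℝ E) → Fin (Module.finrank ℝ E) → E → ℝ}

/-- **Continuity of the Oseen–Duhamel integral in `x`** (dominated convergence: the integrand is
smooth in `x` with the `x`-independent integrable majorant `8829 B (ν(t-s))^{-1/2}`). [folklore] -/
theorem continuous_mildDuhamel_space (hF : IsBddCtsForcing T B F) (hν : 0 < ν) {t : ℝ}
    (ht : t ∈ Ioc 0 T) : Continuous fun x => mildDuhamel ν F t x := by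
  unfold mildDuhamel
  have hmaj : Integrable (fun s : ℝ => 8829 * ν ^ (-(1 / 2 : ℝ)) * B * (t - s) ^ (-(1 / 2 : ℝ)))
      (volume.restrict (Ioo 0 t)) :=
    ((integral_rpow_neg_half_sub ht.1.le).1.const_mul _)
  refine continuous_of_dominated (fun x => aestronglyMeasurable_mildDuhamelIntegrand hE hF hν ht.2 x)
    (fun x => ?_) hmaj ?_
  · refine (ae_restrict_iff' measurableSet_Ioo).2 (Eventually.of_forall fun s hs => ?_)
    refine (norm_mildDuhamelIntegrand_le hE hF hν ht.2 hs x).trans (le_of_eq ?_)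
    rw [Real.mul_rpow hν.le (sub_pos.2 hs.2).le]
    ring
  · refine (ae_restrict_iff' measurableSet_Ioo).2 (Eventually.of_forall fun s hs => ?_)
    exact (contDiff_oseenVec hE (hF.memLp s ⟨hs.1, hs.2.le.trans ht.2⟩)
      (mul_pos hν (sub_pos.2 hs.2)) (n := 0)).continuous

omit hE in
/-- `∫_{[t, t')} (t' - s)^{-1/2} ds = 2 (t' - t)^{1/2}` and integrability, `t ≤ t'`. [folklore] -/
theorem integral_rpow_neg_half_sub_Ico {t t' : ℝ} (htt' : t ≤ t') :
    IntegrableOn (fun s : ℝ => (t' - s) ^ (-(1 / 2 : ℝ))) (Ico t t') ∧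
      ∫ s in Ico t t', (t' - s) ^ (-(1 / 2 : ℝ)) = 2 * (t' - t) ^ (1 / 2 : ℝ) := by
  have hr : (-1 : ℝ) < -(1 / 2) := by norm_num
  have hii : IntervalIntegrable (fun u : ℝ => u ^ (-(1 / 2 : ℝ))) volume 0 (t' - t) :=
    intervalIntegral.intervalIntegrable_rpow' hr
  have hii' : IntervalIntegrable (fun s : ℝ => (t' - s) ^ (-(1 / 2 : ℝ))) volume t t' := by
    have := (hii.comp_sub_left t').symm
    simpa using this
  refine ⟨?_, ?_⟩
  · have h1 := (intervalIntegrable_iff_integrableOn_Icc_of_le htt').1 hii'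
    exact h1.mono_set Ico_subset_Icc_self
  · rw [integral_Ico_eq_integral_Ioo, ← integral_Ioc_eq_integral_Ioo, ← intervalIntegral.integral_of_le htt',
      intervalIntegral.integral_comp_sub_left (fun u : ℝ => u ^ (-(1 / 2 : ℝ))) t', sub_self,
      integral_rpow (Or.inl hr)]
    rw [show (-(1 / 2 : ℝ) + 1) = 1 / 2 by norm_num, Real.zero_rpow (by norm_num)]
    ring

omit hE in
/-- `∫_{(0, t)} (t' - s)^{-1/2} ds = 2 (t'^{1/2} - (t' - t)^{1/2})` and integrability, `0 ≤ t ≤ t'`.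
[folklore] -/
theorem integral_rpow_neg_half_sub_far {t t' : ℝ} (ht : 0 ≤ t) :
    IntegrableOn (fun s : ℝ => (t' - s) ^ (-(1 / 2 : ℝ))) (Ioo 0 t) ∧
      ∫ s in Ioo 0 t, (t' - s) ^ (-(1 / 2 : ℝ)) = 2 * (t' ^ (1 / 2 : ℝ) - (t' - t) ^ (1 / 2 : ℝ)) := by
  have hr : (-1 : ℝ) < -(1 / 2) := by norm_num
  have hii : IntervalIntegrable (fun u : ℝ => u ^ (-(1 / 2 : ℝ))) volume (t' - 0) (t' - t) :=
    intervalIntegral.intervalIntegrable_rpow' hr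
  have hii' : IntervalIntegrable (fun s : ℝ => (t' - s) ^ (-(1 / 2 : ℝ))) volume 0 t := by
    have := (hii.comp_sub_left t')
    simpa using this
  refine ⟨?_, ?_⟩
  · have := (intervalIntegrable_iff_integrableOn_Ioc_of_le ht).1 hii'
    exact (integrableOn_Ioc_iff_integrableOn_Ioo).1 this
  · rw [← integral_Ioc_eq_integral_Ioo, ← intervalIntegral.integral_of_le ht,
      intervalIntegral.integral_comp_sub_left (fun u : ℝ => u ^ (-(1 / 2 : ℝ))) t', sub_zero,
      integral_rpow (Or.inl hr)]
    rw [show (-(1 / 2 : ℝ) + 1) = 1 / 2 by norm_num]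
    ring

/-- **Hölder-`½` modulus of the Oseen–Duhamel integral in time** (uniformly in `x`): for
`0 < t ≤ t' ≤ T`,
`‖𝒟_ν[F](t')(x) - 𝒟_ν[F](t)(x)‖ ≤ 5742000 B ν^{-1/2} (t' - t)^{1/2}`.
The new piece `∫ₜ^{t'}` is `O((t'-t)^{1/2})` by the `L^∞` bound, and on `(0, t)` the variation of the
clock costs `2862000 B ((ν(t-s))^{-1/2} - (ν(t'-s))^{-1/2})`, whose integral is
`5724000 B ν^{-1/2} (t^{1/2} - t'^{1/2} + (t'-t)^{1/2}) ≤ 5724000 B ν^{-1/2} (t'-t)^{1/2}`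
(Leray 1934, §12; Ożański–Pooley 2018, Lemma 6.9 (i): `w ∈ C((0,T); L^∞)`). [folklore] -/
theorem norm_mildDuhamel_sub_le (hF : IsBddCtsForcing T B F) (hν : 0 < ν) {t t' : ℝ}
    (ht : 0 < t) (htt' : t ≤ t') (ht' : t' ≤ T) (x : E) :
    ‖mildDuhamel ν F t' x - mildDuhamel ν F t x‖ ≤
      5742000 * B * ν ^ (-(1 / 2 : ℝ)) * (t' - t) ^ (1 / 2 : ℝ) := by
  have htT : t ∈ Ioc 0 T := ⟨ht, htt'.trans ht'⟩
  have ht'T : t' ∈ Ioc 0 T := ⟨ht.trans_le htt', ht'⟩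
  have hB := hF.nonneg
  set g : ℝ → E := fun s => oseenVec (ν * (t - s)) (F s) x with hg
  set g' : ℝ → E := fun s => oseenVec (ν * (t' - s)) (F s) x with hg'
  have hgi : IntegrableOn g (Ioo 0 t) := integrableOn_mildDuhamelIntegrand hE hF hν htT x
  have hg'i : IntegrableOn g' (Ioo 0 t') := integrableOn_mildDuhamelIntegrand hE hF hν ht'T x
  -- split `(0, t') = (0, t) ∪ [t, t')`
  have hsplit : mildDuhamel ν F t' x = (∫ s in Ioo 0 t, g' s) + ∫ s in Ico t t', g' s := by
    unfold mildDuhamel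
    rw [← Ioo_union_Ico_eq_Ioo ht htt', setIntegral_union (Set.disjoint_left.2 fun s h1 h2 => ?_)
      measurableSet_Ico (hg'i.mono_set fun s hs => ⟨hs.1, hs.2.trans_le htt'⟩)
      (hg'i.mono_set fun s hs => ⟨ht.trans_le hs.1, hs.2⟩)]
    exact absurd h1.2 (not_lt.2 h2.1)
  have hD : mildDuhamel ν F t x = ∫ s in Ioo 0 t, g s := rfl
  -- (1) the near piece
  have hnear : ‖∫ s in Ico t t', g' s‖ ≤ 17658 * B * ν ^ (-(1 / 2 : ℝ)) * (t' - t) ^ (1 / 2 : ℝ) := by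
    have hmaj : IntegrableOn (fun s : ℝ => 8829 * ν ^ (-(1 / 2 : ℝ)) * B * (t' - s) ^ (-(1 / 2 : ℝ)))
        (Ico t t') := ((integral_rpow_neg_half_sub_Ico htt').1.const_mul _)
    refine (norm_integral_le_of_norm_le hmaj ((ae_restrict_iff' measurableSet_Ico).2
      (Eventually.of_forall fun s hs => ?_))).trans (le_of_eq ?_)
    · rcases eq_or_lt_of_le hs.1 with h | h
      · -- `s = t`: the point has measure zero but we still need the bound; use `t < t'` or triviality
        subst h
        rcases eq_or_lt_of_le htt' with h2 | h2
        · exact absurd hs.2 (by rw [h2]; exact lt_irrefl _)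
        · refine (norm_mildDuhamelIntegrand_le hE hF hν ht' ⟨ht, h2⟩ x).trans (le_of_eq ?_)
          rw [Real.mul_rpow hν.le (sub_pos.2 h2).le]; ring
      · refine (norm_mildDuhamelIntegrand_le hE hF hν ht' ⟨ht.trans h, hs.2⟩ x).trans (le_of_eq ?_)
        rw [Real.mul_rpow hν.le (sub_pos.2 hs.2).le]; ring
    · rw [integral_const_mul, (integral_rpow_neg_half_sub_Ico htt').2]; ring
  -- (2) the far piece
  have hfar : ‖(∫ s in Ioo 0 t, g' s) - ∫ s in Ioo 0 t, g s‖ ≤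
      5724000 * B * ν ^ (-(1 / 2 : ℝ)) * (t ^ (1 / 2 : ℝ) - t' ^ (1 / 2 : ℝ) + (t' - t) ^ (1 / 2 : ℝ)) := by
    rw [← integral_sub (hg'i.mono_set fun s hs => ⟨hs.1, hs.2.trans_le htt'⟩) hgi]
    have hmaj : IntegrableOn (fun s : ℝ => 2862000 * B * ν ^ (-(1 / 2 : ℝ)) *
        ((t - s) ^ (-(1 / 2 : ℝ)) - (t' - s) ^ (-(1 / 2 : ℝ)))) (Ioo 0 t) :=
      (((integral_rpow_neg_half_sub ht.le).1.sub (integral_rpow_neg_half_sub_far (t' := t') ht.le).1).const_mul _)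
    refine (norm_integral_le_of_norm_le hmaj ((ae_restrict_iff' measurableSet_Ioo).2
      (Eventually.of_forall fun s hs => ?_))).trans (le_of_eq ?_)
    · have hsT : s ∈ Ioc 0 T := ⟨hs.1, hs.2.le.trans htT.2⟩
      have hτ : 0 < ν * (t - s) := mul_pos hν (sub_pos.2 hs.2)
      have hττ' : ν * (t - s) ≤ ν * (t' - s) := by nlinarith
      refine (norm_oseenVec_sub_le hE (hF.memLp s hsT) hB (hF.bound s hsT) hτ hττ' x).trans (le_of_eq ?_)
      rw [Real.mul_rpow hν.le (sub_pos.2 hs.2).le, Real.mul_rpow hν.le (by linarith [hs.2] : (0:ℝ) ≤ t' - s)]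
      ring
    · rw [integral_const_mul, integral_sub (integral_rpow_neg_half_sub ht.le).1
        (integral_rpow_neg_half_sub_far (t' := t') ht.le).1, (integral_rpow_neg_half_sub ht.le).2,
        (integral_rpow_neg_half_sub_far (t' := t') ht.le).2]
      ring
  -- (3) `t^{1/2} - t'^{1/2} + (t'-t)^{1/2} ≤ (t'-t)^{1/2}` and assembly
  have hmono : t ^ (1 / 2 : ℝ) ≤ t' ^ (1 / 2 : ℝ) := Real.rpow_le_rpow ht.le htt' (by norm_num)
  have hd0 : 0 ≤ (t' - t) ^ (1 / 2 : ℝ) := Real.rpow_nonneg (sub_nonneg.2 htt') _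
  have hν0 : 0 ≤ ν ^ (-(1 / 2 : ℝ)) := Real.rpow_nonneg hν.le _
  calc ‖mildDuhamel ν F t' x - mildDuhamel ν F t x‖
      = ‖(∫ s in Ico t t', g' s) + ((∫ s in Ioo 0 t, g' s) - ∫ s in Ioo 0 t, g s)‖ := by
        rw [hsplit, hD]; congr 1; abel
    _ ≤ ‖∫ s in Ico t t', g' s‖ + ‖(∫ s in Ioo 0 t, g' s) - ∫ s in Ioo 0 t, g s‖ := norm_add_le _ _
    _ ≤ 17658 * B * ν ^ (-(1 / 2 : ℝ)) * (t' - t) ^ (1 / 2 : ℝ) +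
        5724000 * B * ν ^ (-(1 / 2 : ℝ)) * (t ^ (1 / 2 : ℝ) - t' ^ (1 / 2 : ℝ) + (t' - t) ^ (1 / 2 : ℝ)) :=
        add_le_add hnear hfar
    _ ≤ 17658 * B * ν ^ (-(1 / 2 : ℝ)) * (t' - t) ^ (1 / 2 : ℝ) +
        5724000 * B * ν ^ (-(1 / 2 : ℝ)) * (t' - t) ^ (1 / 2 : ℝ) := by
        refine add_le_add le_rfl (mul_le_mul_of_nonneg_left
          (show t ^ (1/2:ℝ) - t' ^ (1/2:ℝ) + (t' - t) ^ (1/2:ℝ) ≤ (t' - t) ^ (1/2:ℝ) by linarith) ?_)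
        exact mul_nonneg (mul_nonneg (by norm_num) hB) hν0
    _ ≤ 5742000 * B * ν ^ (-(1 / 2 : ℝ)) * (t' - t) ^ (1 / 2 : ℝ) := by nlinarith [mul_nonneg (mul_nonneg hB hν0) hd0]

/-- The modulus from `t = 0`: `‖𝒟_ν[F](t')(x)‖ ≤ 5742000 B ν^{-1/2} t'^{1/2}` (the `L^∞` bound, weakened
to the common constant). [folklore] -/
theorem norm_mildDuhamel_sub_le' (hF : IsBddCtsForcing T B F) (hν : 0 < ν) {t t' : ℝ}
    (ht : 0 ≤ t) (htt' : t ≤ t') (ht' : t' ≤ T) (x : E) :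
    ‖mildDuhamel ν F t' x - mildDuhamel ν F t x‖ ≤
      5742000 * B * ν ^ (-(1 / 2 : ℝ)) * (t' - t) ^ (1 / 2 : ℝ) := by
  rcases eq_or_lt_of_le ht with h | h
  · subst h
    rw [mildDuhamel_of_nonpos le_rfl, sub_zero, sub_zero]
    rcases eq_or_lt_of_le htt' with h2 | h2
    · subst h2
      rw [mildDuhamel_of_nonpos le_rfl, norm_zero]
      exact mul_nonneg (mul_nonneg (mul_nonneg (by norm_num) hF.nonneg) (Real.rpow_nonneg hν.le _))
        (Real.rpow_nonneg le_rfl _)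
    · refine (norm_mildDuhamel_le hE hF hν ⟨h2, ht'⟩ x).trans ?_
      have := hF.nonneg
      nlinarith [mul_nonneg (mul_nonneg hF.nonneg (Real.rpow_nonneg hν.le (-(1/2:ℝ))))
        (Real.rpow_nonneg h2.le (1/2:ℝ))]
  · exact norm_mildDuhamel_sub_le hE hF hν h htt' ht' x

/-- **Joint continuity of the Oseen–Duhamel integral on `[0, T] × E`** (Hölder modulus in `t`
uniformly in `x`, continuity in `x` at each fixed `t`). [folklore] -/
theorem continuousOn_mildDuhamel (hF : IsBddCtsForcing T B F) (hν : 0 < ν) :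
    ContinuousOn (fun q : ℝ × E => mildDuhamel ν F q.1 q.2) (Icc 0 T ×ˢ univ) := by
  rintro ⟨t, x⟩ ⟨ht, -⟩
  rw [ContinuousWithinAt, tendsto_iff_norm_sub_tendsto_zero]
  -- continuity in `x` at the fixed time `t`
  have hx : Tendsto (fun q : ℝ × E => ‖mildDuhamel ν F t q.2 - mildDuhamel ν F t x‖)
      (𝓝[Icc 0 T ×ˢ univ] (t, x)) (𝓝 0) := by
    rcases eq_or_lt_of_le ht.1 with h | h
    · subst h
      simp only [mildDuhamel_of_nonpos le_rfl, sub_self, norm_zero]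
      exact tendsto_const_nhds
    · have hc := (continuous_mildDuhamel_space hE hF hν ⟨h, ht.2⟩).tendsto x
      have h2 : Tendsto (fun q : ℝ × E => mildDuhamel ν F t q.2) (𝓝[Icc 0 T ×ˢ univ] (t, x))
          (𝓝 (mildDuhamel ν F t x)) :=
        (hc.comp (continuous_snd.tendsto (t, x))).mono_left nhdsWithin_le_nhds
      have := (tendsto_iff_norm_sub_tendsto_zero.1 h2)
      exact this
  -- the time modulus
  have hK0 : 0 ≤ 5742000 * B * ν ^ (-(1 / 2 : ℝ)) :=
    mul_nonneg (mul_nonneg (by norm_num) hF.nonneg) (Real.rpow_nonneg hν.le _)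
  have hmod : ∀ q : ℝ × E, q ∈ Icc 0 T ×ˢ (univ : Set E) →
      ‖mildDuhamel ν F q.1 q.2 - mildDuhamel ν F t q.2‖ ≤
        5742000 * B * ν ^ (-(1 / 2 : ℝ)) * |q.1 - t| ^ (1 / 2 : ℝ) := by
    rintro ⟨t', x'⟩ ⟨ht', -⟩
    rcases le_total t t' with h | h
    · rw [abs_of_nonneg (sub_nonneg.2 h)]
      exact norm_mildDuhamel_sub_le' hE hF hν ht.1 h ht'.2 x'
    · rw [norm_sub_rev, abs_of_nonpos (sub_nonpos.2 h), neg_sub]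
      exact norm_mildDuhamel_sub_le' hE hF hν ht'.1 h ht.2 x'
  have ht_tend : Tendsto (fun q : ℝ × E => 5742000 * B * ν ^ (-(1 / 2 : ℝ)) * |q.1 - t| ^ (1 / 2 : ℝ))
      (𝓝[Icc 0 T ×ˢ univ] (t, x)) (𝓝 0) := by
    have h1 : Tendsto (fun q : ℝ × E => |q.1 - t|) (𝓝 (t, x)) (𝓝 0) := by
      have hc : Continuous fun q : ℝ × E => |q.1 - t| := (continuous_fst.sub continuous_const).abs
      have := hc.tendsto (t, x)
      simpa using this
    have h2 : Tendsto (fun q : ℝ × E => |q.1 - t| ^ (1 / 2 : ℝ)) (𝓝 (t, x)) (𝓝 0) := by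
      have := h1.rpow_const (p := (1 / 2 : ℝ)) (Or.inr (by norm_num))
      rwa [Real.zero_rpow (by norm_num)] at this
    have := (h2.const_mul (5742000 * B * ν ^ (-(1 / 2 : ℝ)))).mono_left (nhdsWithin_le_nhds (s := Icc 0 T ×ˢ univ))
    rwa [mul_zero] at this
  have hsum : Tendsto (fun q : ℝ × E => 5742000 * B * ν ^ (-(1 / 2 : ℝ)) * |q.1 - t| ^ (1 / 2 : ℝ) +
      ‖mildDuhamel ν F t q.2 - mildDuhamel ν F t x‖) (𝓝[Icc 0 T ×ˢ univ] (t, x)) (𝓝 0) := by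
    have := ht_tend.add hx
    rwa [add_zero] at this
  refine squeeze_zero_norm' ?_ hsum
  filter_upwards [eventually_mem_nhdsWithin] with q hq
  rw [norm_norm]
  calc ‖mildDuhamel ν F q.1 q.2 - mildDuhamel ν F t x‖
      ≤ ‖mildDuhamel ν F q.1 q.2 - mildDuhamel ν F t q.2‖ + ‖mildDuhamel ν F t q.2 - mildDuhamel ν F t x‖ :=
        norm_sub_le_norm_sub_add_norm_sub _ _ _
    _ ≤ _ := add_le_add (hmod q hq) le_rfl

end DuhamelContinuity

section ForcingAlgebra

variable {E : Type*} [NormedAddCommGroup E] [InnerProductSpace ℝ E] [FiniteDimensional ℝ E]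
  [MeasurableSpace E] [BorelSpace E]

variable {T B B' ν : ℝ} {F G : ℝ → Fin (Module.finrank ℝ E) → Fin (Module.finrank ℝ E) → E → ℝ}

/-- Restriction of a bounded continuous forcing to a shorter time interval. [folklore] -/
theorem IsBddCtsForcing.mono (hF : IsBddCtsForcing T B F) {T' : ℝ} (hT' : T' ≤ T) :
    IsBddCtsForcing T' B F where
  memLp s hs := hF.memLp s ⟨hs.1, hs.2.trans hT'⟩
  bound s hs := hF.bound s ⟨hs.1, hs.2.trans hT'⟩
  nonneg := hF.nonneg
  cont s hs j k := (hF.cont s ⟨hs.1, hs.2.trans hT'⟩ j k).mono_left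
    (nhdsWithin_mono _ fun _ hs' => ⟨hs'.1, hs'.2.trans hT'⟩)

/-- **Difference of forcings** with a prescribed componentwise bound `Bd` of the difference. [folklore] -/
theorem IsBddCtsForcing.sub (hF : IsBddCtsForcing T B F) (hG : IsBddCtsForcing T B' G) {Bd : ℝ}
    (hBd0 : 0 ≤ Bd)
    (hBd : ∀ s ∈ Ioc 0 T, ∀ j k, eLpNorm (fun y => F s j k y - G s j k y) ∞ volume ≤ ENNReal.ofReal Bd) :
    IsBddCtsForcing T Bd (fun s j k y => F s j k y - G s j k y) where
  memLp s hs j k := (hF.memLp s hs j k).sub (hG.memLp s hs j k)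
  bound := hBd
  nonneg := hBd0
  cont s hs j k := by
    have h1 := (hF.cont s hs j k).add (hG.cont s hs j k)
    rw [add_zero] at h1
    refine tendsto_of_tendsto_of_tendsto_of_le_of_le' tendsto_const_nhds h1
      (Eventually.of_forall fun _ => bot_le) ?_
    filter_upwards [eventually_mem_nhdsWithin] with s' hs'
    have heq : (fun y => (F s' j k y - G s' j k y) - (F s j k y - G s j k y)) =
        (fun y => F s' j k y - F s j k y) - fun y => G s' j k y - G s j k y := by
      funext y; simp only [Pi.sub_apply]; ring
    rw [heq]
    exact eLpNorm_sub_le (((hF.memLp s' hs' j k).sub (hF.memLp s hs j k)).1)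
      (((hG.memLp s' hs' j k).sub (hG.memLp s hs j k)).1) le_top

variable (hE : Module.finrank ℝ E = 3)
include hE

/-- **Linearity of the Oseen–Duhamel integral**: `𝒟[F] - 𝒟[G] = 𝒟[F - G]`. [folklore] -/
theorem mildDuhamel_sub (hF : IsBddCtsForcing T B F) (hG : IsBddCtsForcing T B' G) (hν : 0 < ν)
    {t : ℝ} (ht : t ∈ Ioc 0 T) (x : E) :
    mildDuhamel ν F t x - mildDuhamel ν G t x =
      mildDuhamel ν (fun s j k y => F s j k y - G s j k y) t x := by
  unfold mildDuhamel
  rw [← integral_sub (integrableOn_mildDuhamelIntegrand hE hF hν ht x) (integrableOn_mildDuhamelIntegrand hE hG hν ht x)]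
  refine setIntegral_congr_fun measurableSet_Ioo fun s hs => ?_
  have hsT : s ∈ Ioc 0 T := ⟨hs.1, hs.2.le.trans ht.2⟩
  exact (oseenVec_sub_of_top hE (hF.memLp s hsT) (hG.memLp s hsT) (mul_pos hν (sub_pos.2 hs.2)) x).symm

/-- **The Oseen–Duhamel integral is continuous in time in the sup norm** on `[0, T]`
(from the Hölder modulus). [folklore] -/
theorem tendsto_eLpNorm_mildDuhamel_sub (hF : IsBddCtsForcing T B F) (hν : 0 < ν) {t : ℝ}
    (ht : t ∈ Icc 0 T) :
    Tendsto (fun t' => eLpNorm (fun x => mildDuhamel ν F t' x - mildDuhamel ν F t x) ∞ volume)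
      (𝓝[Icc 0 T] t) (𝓝 0) := by
  set K : ℝ := 5742000 * B * ν ^ (-(1 / 2 : ℝ)) with hK
  have hK0 : 0 ≤ K := mul_nonneg (mul_nonneg (by norm_num) hF.nonneg) (Real.rpow_nonneg hν.le _)
  have hmod : ∀ t' ∈ Icc 0 T, ∀ x, ‖mildDuhamel ν F t' x - mildDuhamel ν F t x‖ ≤ K * |t' - t| ^ (1 / 2 : ℝ) := by
    intro t' ht' x
    rcases le_total t t' with h | h
    · rw [abs_of_nonneg (sub_nonneg.2 h)]
      exact norm_mildDuhamel_sub_le' hE hF hν ht.1 h ht'.2 x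
    · rw [norm_sub_rev, abs_of_nonpos (sub_nonpos.2 h), neg_sub]
      exact norm_mildDuhamel_sub_le' hE hF hν ht'.1 h ht.2 x
  have hb : Tendsto (fun t' => ENNReal.ofReal (K * |t' - t| ^ (1 / 2 : ℝ))) (𝓝[Icc 0 T] t) (𝓝 0) := by
    have h1 : Tendsto (fun t' : ℝ => |t' - t|) (𝓝 t) (𝓝 0) := by
      have hc : Continuous fun t' : ℝ => |t' - t| := (continuous_id.sub continuous_const).abs
      have := hc.tendsto t
      simpa using this
    have h2 : Tendsto (fun t' : ℝ => K * |t' - t| ^ (1 / 2 : ℝ)) (𝓝 t) (𝓝 0) := by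
      have := (h1.rpow_const (p := (1 / 2 : ℝ)) (Or.inr (by norm_num))).const_mul K
      rwa [Real.zero_rpow (by norm_num), mul_zero] at this
    have h3 := ENNReal.tendsto_ofReal (h2.mono_left (nhdsWithin_le_nhds (s := Icc 0 T)))
    rwa [ENNReal.ofReal_zero] at h3
  refine tendsto_of_tendsto_of_tendsto_of_le_of_le' tendsto_const_nhds hb
    (Eventually.of_forall fun _ => bot_le) ?_
  filter_upwards [eventually_mem_nhdsWithin] with t' ht'
  rw [eLpNorm_exponent_top]
  exact eLpNormEssSup_le_of_ae_bound (Eventually.of_forall fun x => hmod t' ht' x)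

end ForcingAlgebra

section TensorForcing

variable {E : Type*} [NormedAddCommGroup E] [InnerProductSpace ℝ E] [FiniteDimensional ℝ E]
  [MeasurableSpace E] [BorelSpace E]

/-- **Bounded, sup-norm continuous velocity fields** on `(0, T]`: measurable slices, a pointwise
bound `M` and continuity of `s ↦ v(s)` in `L^∞` within `(0, T]` — the velocity class
`C((0,T]; L^∞)` of Leray's regular / Ożański–Pooley's strong solutions (Def. 6.14), here for
everywhere-defined fields. [folklore] -/
structure IsBddCtsVelocity (T M : ℝ) (v : ℝ → E → E) : Prop where
  meas : ∀ s ∈ Ioc 0 T, AEStronglyMeasurable (v s) volume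
  bound : ∀ s ∈ Ioc 0 T, ∀ y, ‖v s y‖ ≤ M
  nonneg : 0 ≤ M
  cont : ∀ s ∈ Ioc 0 T, Tendsto (fun s' => eLpNorm (fun y => v s' y - v s y) ∞ volume)
    (𝓝[Ioc 0 T] s) (𝓝 0)

/-- A bounded, sup-norm continuous velocity is in `C((0,T]; L^∞)` in the sense of the tree's
`ContinuousInLpOn`. [folklore] -/
theorem IsBddCtsVelocity.continuousInLpOn {T M : ℝ} {v : ℝ → E → E} (hv : IsBddCtsVelocity T M v) :
    ContinuousInLpOn (Ioc 0 T) ∞ v :=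
  ⟨fun t ht => memLp_top_of_bound (hv.meas t ht) M (Eventually.of_forall (hv.bound t ht)),
    fun t₀ ht₀ => (hv.cont t₀ ht₀).congr fun t => by rfl⟩

variable {T Mv Mw : ℝ} {v w : ℝ → E → E}

/-- `L^∞` bound of a tensor field from an `L^∞` bound of one factor and a pointwise bound of the other.
[folklore] -/
theorem eLpNorm_frameTensor_le_left {a b : E → E} (ha : MemLp a ∞ volume)
    (hb : AEStronglyMeasurable b volume) {Mb : ℝ} (hMb : ∀ y, ‖b y‖ ≤ Mb)
    (j k : Fin (Module.finrank ℝ E)) :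
    eLpNorm (frameTensor a b j k) ∞ volume ≤ eLpNorm a ∞ volume * ENNReal.ofReal Mb := by
  have hae : ∀ᵐ y ∂volume, ‖a y‖ ≤ (eLpNorm a ∞ volume).toReal := by
    have h := ae_le_eLpNormEssSup (f := a) (μ := volume)
    filter_upwards [h] with y hy
    rw [← eLpNorm_exponent_top] at hy
    exact (ENNReal.ofReal_le_iff_le_toReal ha.eLpNorm_ne_top).1 (by rwa [ofReal_norm])
  have h := (memLp_top_frameTensor_of_ae ha.1 hb hae (Eventually.of_forall hMb) ENNReal.toReal_nonneg j k).2
  rwa [ENNReal.ofReal_mul ENNReal.toReal_nonneg, ENNReal.ofReal_toReal ha.eLpNorm_ne_top] at h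

/-- The same with the roles of the factors exchanged. [folklore] -/
theorem eLpNorm_frameTensor_le_right {a b : E → E} (ha : AEStronglyMeasurable a volume)
    {Ma : ℝ} (hMa : ∀ y, ‖a y‖ ≤ Ma) (hMa0 : 0 ≤ Ma) (hb : MemLp b ∞ volume)
    (j k : Fin (Module.finrank ℝ E)) :
    eLpNorm (frameTensor a b j k) ∞ volume ≤ ENNReal.ofReal Ma * eLpNorm b ∞ volume := by
  have hbe : ∀ᵐ y ∂volume, ‖b y‖ ≤ (eLpNorm b ∞ volume).toReal := by
    have h := ae_le_eLpNormEssSup (f := b) (μ := volume)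
    filter_upwards [h] with y hy
    rw [← eLpNorm_exponent_top] at hy
    exact (ENNReal.ofReal_le_iff_le_toReal hb.eLpNorm_ne_top).1 (by rwa [ofReal_norm])
  have h := (memLp_top_frameTensor_of_ae ha hb.1 (Eventually.of_forall hMa) hbe hMa0 j k).2
  rwa [ENNReal.ofReal_mul hMa0, ENNReal.ofReal_toReal hb.eLpNorm_ne_top] at h

/-- **The tensor forcing of two bounded, sup-norm continuous velocity fields is a bounded,
sup-norm continuous forcing** with bound `Mv Mw`: continuity from
`v' ⊗ w' - v ⊗ w = (v' - v) ⊗ w' + v ⊗ (w' - w)`. [folklore] -/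
theorem IsBddCtsVelocity.isBddCtsForcing_frameTensor (hv : IsBddCtsVelocity T Mv v)
    (hw : IsBddCtsVelocity T Mw w) :
    IsBddCtsForcing T (Mv * Mw) (fun s => frameTensor (v s) (w s)) where
  memLp s hs j k := (memLp_top_frameTensor_of_ae (hv.meas s hs) (hw.meas s hs)
    (Eventually.of_forall (hv.bound s hs)) (Eventually.of_forall (hw.bound s hs)) hv.nonneg j k).1
  bound s hs j k := (memLp_top_frameTensor_of_ae (hv.meas s hs) (hw.meas s hs)
    (Eventually.of_forall (hv.bound s hs)) (Eventually.of_forall (hw.bound s hs)) hv.nonneg j k).2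
  nonneg := mul_nonneg hv.nonneg hw.nonneg
  cont s hs j k := by
    -- the majorant `‖v' - v‖_∞ Mw + Mv ‖w' - w‖_∞`
    have hlim : Tendsto (fun s' => eLpNorm (fun y => v s' y - v s y) ∞ volume * ENNReal.ofReal Mw +
        ENNReal.ofReal Mv * eLpNorm (fun y => w s' y - w s y) ∞ volume) (𝓝[Ioc 0 T] s) (𝓝 0) := by
      have h1 := ENNReal.Tendsto.mul_const (hv.cont s hs) (Or.inr ENNReal.ofReal_ne_top) (b := ENNReal.ofReal Mw)
      have h2 := ENNReal.Tendsto.const_mul (hw.cont s hs) (Or.inr ENNReal.ofReal_ne_top) (a := ENNReal.ofReal Mv)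
      rw [zero_mul] at h1
      rw [mul_zero] at h2
      have := h1.add h2
      rwa [add_zero] at this
    refine tendsto_of_tendsto_of_tendsto_of_le_of_le' tendsto_const_nhds hlim
      (Eventually.of_forall fun _ => bot_le) ?_
    filter_upwards [eventually_mem_nhdsWithin] with s' hs'
    have hvm : MemLp (fun y => v s' y - v s y) ∞ volume :=
      memLp_top_of_bound ((hv.meas s' hs').sub (hv.meas s hs)) (Mv + Mv) (Eventually.of_forall fun y =>
        (norm_sub_le _ _).trans (add_le_add (hv.bound s' hs' y) (hv.bound s hs y)))
    have hwm : MemLp (fun y => w s' y - w s y) ∞ volume :=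
      memLp_top_of_bound ((hw.meas s' hs').sub (hw.meas s hs)) (Mw + Mw) (Eventually.of_forall fun y =>
        (norm_sub_le _ _).trans (add_le_add (hw.bound s' hs' y) (hw.bound s hs y)))
    have heq : (fun y => frameTensor (v s') (w s') j k y - frameTensor (v s) (w s) j k y) =
        (frameTensor (fun y => v s' y - v s y) (w s') j k) + frameTensor (v s) (fun y => w s' y - w s y) j k := by
      funext y
      rw [frameTensor_sub_frameTensor]
      rfl
    rw [heq]
    refine (eLpNorm_add_le ?_ ?_ le_top).trans (add_le_add ?_ ?_)
    · exact aestronglyMeasurable_frameTensor hvm.1 (hw.meas s' hs') j k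
    · exact aestronglyMeasurable_frameTensor (hv.meas s hs) hwm.1 j k
    · exact eLpNorm_frameTensor_le_left hvm (hw.meas s' hs') (hw.bound s' hs') j k
    · exact eLpNorm_frameTensor_le_right (hv.meas s hs) (hv.bound s hs) hv.nonneg hwm j k

variable (hE : Module.finrank ℝ E = 3)
include hE

omit hE in
/-- The frame components of the vector operator are the scalar Oseen–heat components. [folklore] -/
theorem inner_oseenVec_frame (τ : ℝ) (G : Fin (Module.finrank ℝ E) → Fin (Module.finrank ℝ E) → E → ℝ) (x : E)
    (i : Fin (Module.finrank ℝ E)) :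
    ⟪oseenVec τ G x, stdOrthonormalBasis ℝ E i⟫ = oseenHeat τ G i x := by
  unfold oseenVec
  rw [sum_inner]
  simp_rw [inner_smul_left]
  rw [Finset.sum_eq_single i]
  · simp
  · intro j _ hji
    simp [(stdOrthonormalBasis ℝ E).inner_eq_zero hji]
  · simp

/-- **The frame components of the Oseen–Duhamel integral** of a bounded continuous forcing are the
time integrals of the scalar Oseen–heat components: `⟪𝒟_ν[F](t)(x), bᵢ⟫ = ∫_{(0,t)} (𝒩_{ν(t-s)}F(s))ᵢ(x) ds`.
[folklore] -/
theorem inner_mildDuhamel_frame {T B ν : ℝ} {F : ℝ → Fin (Module.finrank ℝ E) → Fin (Module.finrank ℝ E) → E → ℝ}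
    (hF : IsBddCtsForcing T B F) (hν : 0 < ν) {t : ℝ} (ht : t ≤ T) (x : E) (i : Fin (Module.finrank ℝ E)) :
    ⟪mildDuhamel ν F t x, stdOrthonormalBasis ℝ E i⟫ = ∫ s in Ioo 0 t, oseenHeat (ν * (t - s)) (F s) i x := by
  rcases le_or_gt t 0 with h0 | h0
  · rw [mildDuhamel_of_nonpos h0, inner_zero_left, Ioo_eq_empty (not_lt.2 h0), Measure.restrict_empty,
      integral_zero_measure]
  unfold mildDuhamel
  rw [real_inner_comm, ← integral_inner (integrableOn_mildDuhamelIntegrand hE hF hν ⟨h0, ht⟩ x) (stdOrthonormalBasis ℝ E i)]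
  exact integral_congr_ae (Eventually.of_forall fun s => by
    show ⟪stdOrthonormalBasis ℝ E i, oseenVec (ν * (t - s)) (F s) x⟫ = oseenHeat (ν * (t - s)) (F s) i x
    rw [real_inner_comm]; exact inner_oseenVec_frame _ _ _ _)

/-- **Bridge to the tree's bilinear Duhamel term** (`OseenHeatDuhamel.lean`): on a rank-one forcing
`F(s) = v(s) ⊗ w(s)` of bounded, sup-norm continuous velocities the general-forcing integral of this file
*is* `oseenHeatDuhamelVec ν 0 v w` (the tree's precedent for such bridges is
`driftDuhamel_eq_oseenHeatDuhamelVec`). [folklore] -/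
theorem mildDuhamel_frameTensor_eq_oseenHeatDuhamelVec {T Mv Mw ν : ℝ} {v w : ℝ → E → E}
    (hv : IsBddCtsVelocity T Mv v) (hw : IsBddCtsVelocity T Mw w) (hν : 0 < ν) {t : ℝ} (ht : t ≤ T) (x : E) :
    mildDuhamel ν (fun s => frameTensor (v s) (w s)) t x = oseenHeatDuhamelVec ν 0 v w t x := by
  -- both sides are determined by their frame components
  have hcomp : ∀ i, ⟪mildDuhamel ν (fun s => frameTensor (v s) (w s)) t x, stdOrthonormalBasis ℝ E i⟫ =
      ⟪oseenHeatDuhamelVec ν 0 v w t x, stdOrthonormalBasis ℝ E i⟫ := fun i => by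
    rw [inner_mildDuhamel_frame hE (hv.isBddCtsForcing_frameTensor hw) hν ht x i, inner_oseenHeatDuhamelVec,
      oseenHeatDuhamel_apply]
  calc mildDuhamel ν (fun s => frameTensor (v s) (w s)) t x
      = ∑ i, ⟪stdOrthonormalBasis ℝ E i, mildDuhamel ν (fun s => frameTensor (v s) (w s)) t x⟫ • stdOrthonormalBasis ℝ E i :=
        ((stdOrthonormalBasis ℝ E).sum_repr' _).symm
    _ = ∑ i, ⟪stdOrthonormalBasis ℝ E i, oseenHeatDuhamelVec ν 0 v w t x⟫ • stdOrthonormalBasis ℝ E i := by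
        refine Finset.sum_congr rfl fun i _ => ?_
        rw [real_inner_comm, hcomp i, real_inner_comm]
    _ = oseenHeatDuhamelVec ν 0 v w t x := (stdOrthonormalBasis ℝ E).sum_repr' _

end TensorForcing

end Literature.Analysis.FluidPDE

end
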